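import Summits.RiemannHypothesis.RiemannHypothesis.Theorems.Splittings.LiIncrEnvelopeWindow
import Summits.RiemannHypothesis.RiemannHypothesis.Theorems.Splittings.LiIncrBlockLawOfRH
import Summits.RiemannHypothesis.RiemannHypothesis.Theorems.Splittings.CostumeDetectors
import Summits.RiemannHypothesis.RiemannHypothesis.Theorems.Splittings.LiOneSidedCriteria
import HarnessLib

/-!
# THE LOW PHASE LAW over the ordinates and the decomposition «K7ev ⟺ RH ∧ PL (±17/2)» (SketchG15 §§1–4, 6)

PRE-CUT (not filed): cell rh-split, seat rh-split-li-bridge g15 (brief sha16 f79c5f09d8bcb036), card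
`run/shared/lean/pub/rh-split/cards/SPLIT-li-bridge.md` §22; kernel source `HOME/rh-split-li-bridge/SketchG15.lean`
sha16 ba4fe6528513c7ef (388 l, 2 defs + 20 theorems, farm rc 0 · 0 err · 0 warn · 0 sorry, std axioms), FROZEN by
RULING #160; cut by the seat into TWO files ≤ 400 l at the scratch's section boundaries (this = §§1–4 + §6; the
no-drift law §5 is `LiLowSumNoDrift`), decl text byte-verbatim; deltas = namespace `RhSplit.LiBridgeG15` ↦
`…Theorems.Splittings.LiLowPhaseLaw`, this header, `set_option linter.dupNamespace false`, and the RULING #160 (c) clause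
added to the docstring of `LowPhaseLaw`.  A typer files it only after the referee's label line and the lead's GO (cell rule).

`λ_n = keiperLiCoeff n`, `Δ_n = liIncr n = λ_{n+1} − λ_n = highPart n Y + lowSum n Y` (tree `LiIncrHighPartSplit`) at every
cut `Y`; `lowSum n Y = Σ_{ρ ∈ zerosBetween 0 Y} m_ρ · 4 sin(θ_γ/2) · sin((n+½)θ_γ)`, `θ_t = liZeroAngle t = 2 arctan(1/(2t))` —
a function of the ORDINATE MULTISET alone (RH-blind: moving a zero off the line at its own ordinate changes no `lowSum`).
`K7ev` := «`λ_n ≤ λ_{n+1}` for all large `n`» (the monotonicity conjecture for the Keiper/Li coefficients, eventual form;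
RH-PLUS by the card's census).
* §1 `phaseCut n = √n · log n` (`Y_n`) and the CELL-COINED predicate `LowPhaseLaw K` («eventually `K − ½ log n ≤ lowSum n Y_n`»;
  not in print; ordinates-only; used only in HYPOTHESIS / conjunct position, never asserted);
* §2 admissibility of the cut (PURE); §3 RH ⟹ `|highPart n Y_n − ½ log n| ≤ 17/2` eventually (tree `highPart_lower`,
  `LiIncrEnvelope.highPart_upper`);
* §4 THE DECOMPOSITION: `RH ∧ PL(17/2) ⟹ K7ev`, `K7ev ⟹ RH` (tree, Bombieri–Lagarias), `RH ∧ K7ev ⟹ PL(−17/2)`, packaged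
  `k7ev_decomposition` — a DECOMPOSITION OF AN RH-PLUS STATEMENT (the conjunct RH is RH), not a splitting of RH; the
  `√n`-cut variant with slope `0.33`;
* §6 RELABELLING DETECTOR `rh_iff_highPart_floor : RH ↔ ∃ C, eventually −C ≤ highPart n Y_n` (so «high-part floor ∧ PL» is
  «RH ∧ PL» in costume).

HONEST LABEL: SPLITTING SEARCH over kernel-typed RH-EQUIVALENCES; a splitting A ∧ B ⟹ RH is CONDITIONAL bookkeeping
unless A and B are both proved; nothing here bears on the truth of RH.  Every theorem below is PURE, RH-FREE, an
RH-CONSEQUENCE (`RiemannHypothesis → …`, possibly with the cell-coined hypothesis `LowPhaseLaw K`), or an RH-equivalence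
labelled RELABELLING; none is a claim about RH, and `LowPhaseLaw` is never asserted.
-/

set_option linter.dupNamespace false

namespace Summit.RiemannHypothesis.RiemannHypothesis.Theorems.Splittings.LiLowPhaseLaw

open Filter Topology Finset
open scoped Real
open Literature.NumberTheory.LFunctions Literature.NumberTheory.LFunctions.SchoenfeldBound
open Summit.RiemannHypothesis.RiemannHypothesis.Theorems.LiTheory
open Summit.RiemannHypothesis.RiemannHypothesis.Theorems.Splittings
open Summit.RiemannHypothesis.RiemannHypothesis.Theorems.Splittings.LiIncrHighPart

/-! ## §1 The cutoff and the low phase law -/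

/-- The phase cutoff `Y_n := √n · log n`. -/
noncomputable def phaseCut (n : ℕ) : ℝ := Real.sqrt n * Real.log n

/-- **LOW PHASE LAW** with threshold constant `K`: eventually `K − ½ log n ≤ lowSum n Y_n`, i.e. the low-zero phase sum
`Σ_{0<γ≤√n log n} 4 m sin(θ_γ/2) sin((n+½)θ_γ)` never undershoots `−½ log n` by more than `−K`.  A statement about
the ORDINATES of the zeros only (RH-blind).  CELL-COINED (rh-split li §22), NOT IN PRINT; ordinates-only; used only as a
HYPOTHESIS / conjunct, never asserted (RULING #160 (c)); HONEST LABEL in the module docstring. -/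
def LowPhaseLaw (K : ℝ) : Prop :=
  ∀ᶠ n : ℕ in atTop, K - Real.log n / 2 ≤ lowSum n (phaseCut n)

/-- Monotonicity in the threshold. PURE. -/
theorem LowPhaseLaw.mono {K K' : ℝ} (hKK : K' ≤ K) (h : LowPhaseLaw K) : LowPhaseLaw K' :=
  Filter.Eventually.mono h fun _ hn ↦ by linarith

/-! ## §2 Admissibility of the cutoff -/

/-- `log n ≤ n^{1/4}/16` eventually. PURE. -/
theorem eventually_log_le_rpow_quarter :
    ∀ᶠ n : ℕ in atTop, Real.log n ≤ 1 / 16 * (n : ℝ) ^ ((1 : ℝ) / 4) := by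
  have h1 : ∀ᶠ x : ℝ in atTop, ‖Real.log x‖ ≤ 1 / 16 * ‖x ^ ((1 : ℝ) / 4)‖ :=
    (isLittleO_log_rpow_atTop (by norm_num : (0 : ℝ) < 1 / 4)).bound (by norm_num)
  filter_upwards [tendsto_natCast_atTop_atTop.eventually h1, eventually_ge_atTop 1] with n hn hn1
  have hn1' : (1 : ℝ) ≤ n := by exact_mod_cast hn1
  rwa [Real.norm_eq_abs, Real.norm_eq_abs, abs_of_nonneg (Real.log_nonneg hn1'),
    abs_of_nonneg (Real.rpow_nonneg (by linarith) _)] at hn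

/-- The cutoff `Y_n = √n log n` is eventually ADMISSIBLE for the tree's two-sided high-part bounds, with the
error term `n(0.34 log Y_n + 3.5)/Y_n² ≤ ½`. PURE. -/
theorem eventually_phaseCut_admissible : ∀ᶠ n : ℕ in atTop,
    1 ≤ n ∧ 30 ≤ phaseCut n ∧ 4 * phaseCut n * (Real.log ((n : ℝ) + 1) + 2) ≤ n ∧
      (n : ℝ) * (0.34 * Real.log (phaseCut n) + 3.5) / phaseCut n ^ 2 ≤ 1 / 2 := by
  filter_upwards [eventually_log_le_rpow_quarter, eventually_ge_atTop 900,
    (Real.tendsto_log_atTop.comp tendsto_natCast_atTop_atTop).eventually_ge_atTop 4] with n hlog hn900 hlog4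
  have hnr : (900 : ℝ) ≤ n := by exact_mod_cast hn900
  have hn0 : (0 : ℝ) < n := by linarith
  have hL4 : (4 : ℝ) ≤ Real.log n := hlog4
  set L := Real.log (n : ℝ) with hL
  set q := (n : ℝ) ^ ((1 : ℝ) / 4) with hq
  have hq0 : 0 ≤ q := Real.rpow_nonneg hn0.le _
  have hqq : q * q = Real.sqrt n := by
    rw [hq, ← Real.rpow_add hn0, Real.sqrt_eq_rpow]; norm_num
  have hsq : Real.sqrt n * Real.sqrt n = n := Real.mul_self_sqrt hn0.le
  have hs30 : 30 ≤ Real.sqrt (n : ℝ) :=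
    calc (30 : ℝ) = Real.sqrt (30 ^ 2) := (Real.sqrt_sq (by norm_num)).symm
      _ ≤ Real.sqrt n := Real.sqrt_le_sqrt (by linarith)
  have hs0 : 0 < Real.sqrt (n : ℝ) := by linarith
  have hq1 : 1 ≤ q := by nlinarith
  have hL0 : 0 < L := by linarith
  have hY : phaseCut n = Real.sqrt n * L := rfl
  have hY0 : 0 < Real.sqrt n * L := mul_pos hs0 hL0
  refine ⟨by omega, ?_, ?_, ?_⟩
  · rw [hY]; nlinarith
  · have hlog2 : Real.log ((n : ℝ) + 1) ≤ L + 1 := by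
      have h2 : Real.log ((n : ℝ) + 1) ≤ Real.log (2 * n) :=
        Real.log_le_log (by linarith) (by linarith)
      rw [Real.log_mul two_ne_zero hn0.ne'] at h2
      linarith [Real.log_two_lt_d9]
    have h1 : 4 * (Real.sqrt n * L) * (Real.log ((n : ℝ) + 1) + 2) ≤
        4 * (Real.sqrt n * L) * (L + 3) :=
      mul_le_mul_of_nonneg_left (by linarith) (by positivity)
    have h2 : 4 * L * (L + 3) ≤ q * q := by nlinarith
    rw [hY]
    calc 4 * (Real.sqrt n * L) * (Real.log ((n : ℝ) + 1) + 2)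
        ≤ 4 * (Real.sqrt n * L) * (L + 3) := h1
      _ = Real.sqrt n * (4 * L * (L + 3)) := by ring
      _ ≤ Real.sqrt n * (q * q) := mul_le_mul_of_nonneg_left h2 hs0.le
      _ = n := by rw [hqq, hsq]
  · rw [hY, div_le_iff₀ (by positivity : (0 : ℝ) < (Real.sqrt n * L) ^ 2)]
    have hLs : L ≤ Real.sqrt n := by nlinarith
    have hYle : Real.sqrt n * L ≤ n :=
      calc Real.sqrt n * L ≤ Real.sqrt n * Real.sqrt n := mul_le_mul_of_nonneg_left hLs hs0.le
        _ = n := hsq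
    have hlogY : Real.log (Real.sqrt n * L) ≤ L := Real.log_le_log hY0 hYle
    have hsqY : (Real.sqrt n * L) ^ 2 = n * L ^ 2 := by rw [mul_pow, Real.sq_sqrt hn0.le]
    rw [hsqY]
    have hkey : 0.34 * L + 3.5 ≤ 1 / 2 * L ^ 2 := by nlinarith
    have h3 : 0.34 * Real.log (Real.sqrt n * L) + 3.5 ≤ 1 / 2 * L ^ 2 := by linarith
    calc (n : ℝ) * (0.34 * Real.log (Real.sqrt n * L) + 3.5) ≤ n * (1 / 2 * L ^ 2) :=
          mul_le_mul_of_nonneg_left h3 hn0.le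
      _ = 1 / 2 * (n * L ^ 2) := by ring

/-! ## §3 The high part at the cut `Y_n` under RH -/

/-- **RH ⟹ the high part is `½ log n + O(1)` at the cut `Y_n = √n log n`:** eventually
`|highPart n Y_n − ½ log n| ≤ 17/2` (tree `highPart_lower` + `LiIncrEnvelope.highPart_upper`, error term `≤ ½` by §2).
RH-CONSEQUENCE. -/
theorem highPart_phaseCut_sandwich (hRH : _root_.RiemannHypothesis) :
    ∀ᶠ n : ℕ in atTop, |highPart n (phaseCut n) - Real.log n / 2| ≤ 17 / 2 := by
  filter_upwards [eventually_phaseCut_admissible] with n ⟨hn, h30, h4, hE⟩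
  have h1 := highPart_lower hRH hn h30 h4
  have h2 := LiIncrEnvelope.highPart_upper hRH hn h30 h4
  rw [abs_le]; constructor <;> linarith

/-- Hence under RH the increment IS the low phase sum up to `½ log n ± 17/2`:
eventually `|Δ_n − ½ log n − lowSum n Y_n| ≤ 17/2`. RH-CONSEQUENCE. -/
theorem liIncr_sub_lowSum_sandwich (hRH : _root_.RiemannHypothesis) :
    ∀ᶠ n : ℕ in atTop, |liIncr n - Real.log n / 2 - lowSum n (phaseCut n)| ≤ 17 / 2 := by
  filter_upwards [highPart_phaseCut_sandwich hRH] with n h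
  rwa [liIncr_eq_highPart_add_lowSum n (phaseCut n), add_sub_right_comm, add_sub_cancel_right]

/-! ## §4 The decomposition of `K7ev` -/

/-- **RH ∧ PL(17/2) ⟹ K7ev**: Li's coefficients are eventually non-decreasing. RH-CONSEQUENCE (conditional on `PL`). -/
theorem li_eventually_monotone_of_rh_of_lowPhaseLaw (hRH : _root_.RiemannHypothesis)
    (hPL : LowPhaseLaw (17 / 2)) :
    ∃ n₀ : ℕ, ∀ n : ℕ, n₀ ≤ n → keiperLiCoeff n ≤ keiperLiCoeff (n + 1) := by
  obtain ⟨n₀, h⟩ := eventually_atTop.1 ((highPart_phaseCut_sandwich hRH).and hPL)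
  refine ⟨n₀, fun n hn ↦ ?_⟩
  obtain ⟨h1, h2⟩ := h n hn
  have h3 : keiperLiCoeff (n + 1) - keiperLiCoeff n =
      highPart n (phaseCut n) + lowSum n (phaseCut n) := liIncr_eq_highPart_add_lowSum n _
  have h4 := (abs_le.1 h1).1
  linarith

/-- The strict form: **RH ∧ PL(K) with `K > 17/2` ⟹ `λ_n < λ_{n+1}` eventually.** RH-CONSEQUENCE (conditional on `PL`). -/
theorem li_eventually_strictMono_of_rh_of_lowPhaseLaw (hRH : _root_.RiemannHypothesis) {K : ℝ}
    (hK : 17 / 2 < K) (hPL : LowPhaseLaw K) :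
    ∃ n₀ : ℕ, ∀ n : ℕ, n₀ ≤ n → keiperLiCoeff n < keiperLiCoeff (n + 1) := by
  obtain ⟨n₀, h⟩ := eventually_atTop.1 ((highPart_phaseCut_sandwich hRH).and hPL)
  refine ⟨n₀, fun n hn ↦ ?_⟩
  obtain ⟨h1, h2⟩ := h n hn
  have h3 : keiperLiCoeff (n + 1) - keiperLiCoeff n =
      highPart n (phaseCut n) + lowSum n (phaseCut n) := liIncr_eq_highPart_add_lowSum n _
  have h4 := (abs_le.1 h1).1
  linarith

/-- **K7ev ⟹ RH** (RH-FREE; the tree's Bombieri–Lagarias bridge `CostumeDetectors.rh_of_keiperLiCoeff_eventually_monotone`). -/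
private theorem rh_of_li_eventually_monotone
    (hK7 : ∃ n₀ : ℕ, ∀ n : ℕ, n₀ ≤ n → keiperLiCoeff n ≤ keiperLiCoeff (n + 1)) :
    _root_.RiemannHypothesis :=
  CostumeDetectors.rh_of_keiperLiCoeff_eventually_monotone hK7

/-- **RH ∧ K7ev ⟹ PL(−17/2)** (so, with the previous theorem, **K7ev ⟹ PL(−17/2)**). RH-CONSEQUENCE. -/
theorem lowPhaseLaw_of_rh_of_li_eventually_monotone (hRH : _root_.RiemannHypothesis)
    (hK7 : ∃ n₀ : ℕ, ∀ n : ℕ, n₀ ≤ n → keiperLiCoeff n ≤ keiperLiCoeff (n + 1)) :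
    LowPhaseLaw (-(17 / 2)) := by
  obtain ⟨n₀, hn₀⟩ := hK7
  show ∀ᶠ n : ℕ in atTop, -(17 / 2) - Real.log n / 2 ≤ lowSum n (phaseCut n)
  filter_upwards [highPart_phaseCut_sandwich hRH, eventually_ge_atTop n₀] with n h1 hn
  have h2 := hn₀ n hn
  have h3 : keiperLiCoeff (n + 1) - keiperLiCoeff n =
      highPart n (phaseCut n) + lowSum n (phaseCut n) := liIncr_eq_highPart_add_lowSum n _
  have h4 := (abs_le.1 h1).2
  linarith

/-- **THE DECOMPOSITION OF `K7ev`.**  `K7ev ⟹ RH ∧ PL(−17/2)` and `RH ∧ PL(17/2) ⟹ K7ev`: eventual monotonicity of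
Li's coefficients is RH plus the ordinates-only low phase law, up to the additive constant `17` in the threshold.
The first conjunct is RH itself — this DECOMPOSES AN RH-PLUS STATEMENT, it does not split RH. -/
theorem k7ev_decomposition :
    ((∃ n₀ : ℕ, ∀ n : ℕ, n₀ ≤ n → keiperLiCoeff n ≤ keiperLiCoeff (n + 1)) →
        _root_.RiemannHypothesis ∧ LowPhaseLaw (-(17 / 2))) ∧
    (_root_.RiemannHypothesis ∧ LowPhaseLaw (17 / 2) →
        ∃ n₀ : ℕ, ∀ n : ℕ, n₀ ≤ n → keiperLiCoeff n ≤ keiperLiCoeff (n + 1)) :=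
  ⟨fun h ↦ ⟨rh_of_li_eventually_monotone h,
      lowPhaseLaw_of_rh_of_li_eventually_monotone (rh_of_li_eventually_monotone h) h⟩,
    fun h ↦ li_eventually_monotone_of_rh_of_lowPhaseLaw h.1 h.2⟩

/-- The same with the summit spelling `Summit.RiemannHypothesis`. -/
theorem k7ev_decomposition' :
    ((∃ n₀ : ℕ, ∀ n : ℕ, n₀ ≤ n → keiperLiCoeff n ≤ keiperLiCoeff (n + 1)) →
        Summit.RiemannHypothesis ∧ LowPhaseLaw (-(17 / 2))) ∧
    (Summit.RiemannHypothesis ∧ LowPhaseLaw (17 / 2) →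
        ∃ n₀ : ℕ, ∀ n : ℕ, n₀ ≤ n → keiperLiCoeff n ≤ keiperLiCoeff (n + 1)) :=
  k7ev_decomposition

/-- **The `√n`-cut variant** (the card's usual cut, §§13–21): at `Y = √n` the tree controls the high part only to within
`0.17 log n + 11.5`, so the sufficient phase law there has SLOPE `0.33`:
RH ∧ «eventually `−(0.33 log n − 11.5) ≤ lowSum n √n`» ⟹ K7ev.  RH-CONSEQUENCE (conditional). -/
theorem li_eventually_monotone_of_rh_of_sqrtPhaseLaw (hRH : _root_.RiemannHypothesis)
    (hPL : ∀ᶠ n : ℕ in atTop, -(0.33 * Real.log n - 11.5) ≤ lowSum n (Real.sqrt n)) :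
    ∃ n₀ : ℕ, ∀ n : ℕ, n₀ ≤ n → keiperLiCoeff n ≤ keiperLiCoeff (n + 1) := by
  have hev := (LiIncrBlockLawOfRH.eventually_sqrt_log_le.and (eventually_ge_atTop 900)).and hPL
  obtain ⟨n₀, h⟩ := eventually_atTop.1 hev
  refine ⟨n₀, fun n hn ↦ ?_⟩
  obtain ⟨⟨hsl, hn900⟩, hlow⟩ := h n hn
  have hnr : (900 : ℝ) ≤ n := by exact_mod_cast hn900
  have hn0 : (0 : ℝ) < n := by linarith
  have hs30 : 30 ≤ Real.sqrt (n : ℝ) :=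
    calc (30 : ℝ) = Real.sqrt (30 ^ 2) := (Real.sqrt_sq (by norm_num)).symm
      _ ≤ Real.sqrt n := Real.sqrt_le_sqrt (by linarith)
  have hlog1 : Real.log ((n : ℝ) + 1) ≤ Real.log (2 * n) :=
    Real.log_le_log (by linarith) (by linarith)
  have h4 : 4 * Real.sqrt n * (Real.log ((n : ℝ) + 1) + 2) ≤ n :=
    le_trans (mul_le_mul_of_nonneg_left (by linarith) (by positivity)) hsl
  have h1 := highPart_lower hRH (by omega) hs30 h4
  have hsq : Real.sqrt (n : ℝ) ^ 2 = n := Real.sq_sqrt hn0.le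
  have hlogs : Real.log (Real.sqrt (n : ℝ)) = Real.log n / 2 := by
    rw [Real.log_sqrt hn0.le]
  rw [hsq, hlogs] at h1
  have herr : (n : ℝ) * (0.34 * (Real.log n / 2) + 3.5) / n = 0.17 * Real.log n + 3.5 := by
    field_simp; ring
  rw [herr] at h1
  have h3 : keiperLiCoeff (n + 1) - keiperLiCoeff n =
      highPart n (Real.sqrt n) + lowSum n (Real.sqrt n) := liIncr_eq_highPart_add_lowSum n _
  linarith

/-! ## §6 The high-part floor is RH again (RELABELLING) — so «high-part floor ∧ PL» is no splitting -/

/-- `Y_n = √n · log n ≤ 2n` (from `log n ≤ 2√n`). PURE. -/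
theorem phaseCut_le_two_mul (n : ℕ) : phaseCut n ≤ 2 * n := by
  unfold phaseCut
  have hn : (0 : ℝ) ≤ n := n.cast_nonneg
  have hlog : Real.log n ≤ (n : ℝ) ^ (1 / 2 : ℝ) / (1 / 2 : ℝ) :=
    Real.log_le_rpow_div hn (by norm_num)
  rw [← Real.sqrt_eq_rpow] at hlog
  have hs : 0 ≤ Real.sqrt n := Real.sqrt_nonneg _
  calc Real.sqrt n * Real.log n ≤ Real.sqrt n * (Real.sqrt n / (1 / 2 : ℝ)) :=
        mul_le_mul_of_nonneg_left hlog hs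
    _ = 2 * (Real.sqrt n * Real.sqrt n) := by ring
    _ = 2 * n := by rw [Real.mul_self_sqrt hn]

/-- RH ⟹ an eventual FLOOR on the high part at the cut: `−17/2 ≤ highPart n Y_n`. RH-CONSEQUENCE. -/
theorem highPart_floor_of_rh (hRH : _root_.RiemannHypothesis) :
    ∀ᶠ n : ℕ in atTop, -(17 / 2 : ℝ) ≤ highPart n (phaseCut n) := by
  filter_upwards [highPart_phaseCut_sandwich hRH] with n hn
  have h := (abs_le.1 hn).1
  have hl : 0 ≤ Real.log n := Real.log_natCast_nonneg n
  linarith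

/-- **RH-FREE converse (Bombieri–Lagarias via the tree's one-sided criterion `LiOneSidedCriteria.rh_of_liIncrFloor`):**
ANY eventual floor `−C ≤ highPart n Y_n` gives RH — because `|lowSum n Y_n| ≤ 12·L(1+L)`, `L = log(⌈Y_n⌉₊ + 2)`
(tree `LiIncrEnvelope.abs_lowSum_le`, RH-free) turns it into a polynomial, hence sub-exponential, floor on the
increments `λ_{n+1} − λ_n`. So «the high part is bounded below» is a RELABELLING of RH, and the conjunction
«high-part floor ∧ PL» is «RH ∧ PL» again — not a splitting. -/
theorem rh_of_highPart_floor {C : ℝ} (h : ∀ᶠ n : ℕ in atTop, -C ≤ highPart n (phaseCut n)) :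
    _root_.RiemannHypothesis := by
  obtain ⟨n₀, hn₀⟩ := eventually_atTop.1 (h.and (eventually_ge_atTop 1))
  have hS : Summit.RiemannHypothesis := by
    refine LiOneSidedCriteria.rh_of_liIncrFloor (σ := 1) (Or.inl rfl) fun ε hε ↦ ?_
    refine ⟨|C| + 336 / ε ^ 2 + 72, n₀, fun n hn ↦ ?_⟩
    obtain ⟨hC, hn1⟩ := hn₀ n hn
    have hn1' : (1 : ℝ) ≤ n := by exact_mod_cast hn1
    have hn0 : (0 : ℝ) ≤ n := n.cast_nonneg
    -- the RH-free low-sum bound, made polynomial in `n`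
    have hlow := LiIncrEnvelope.abs_lowSum_le n (phaseCut n)
    set L := Real.log ((⌈phaseCut n⌉₊ : ℝ) + 2) with hL
    have hY0 : 0 ≤ phaseCut n := by
      unfold phaseCut; exact mul_nonneg (Real.sqrt_nonneg _) (Real.log_natCast_nonneg n)
    have hceil : ((⌈phaseCut n⌉₊ : ℕ) : ℝ) + 2 ≤ 2 * n + 3 := by
      have h1 := (Nat.ceil_lt_add_one hY0).le
      have h2 := phaseCut_le_two_mul n
      linarith
    have hpos : (0 : ℝ) < ((⌈phaseCut n⌉₊ : ℕ) : ℝ) + 2 := by positivity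
    have hL0 : 0 ≤ L := Real.log_nonneg (by linarith)
    have hL1 : L ≤ 2 * n + 2 := by
      have := Real.log_le_sub_one_of_pos hpos
      linarith
    have hlow' : |lowSum n (phaseCut n)| ≤ 168 * (n : ℝ) ^ 2 + 72 := by
      have h1 : 12 * L * (1 + L) ≤ 12 * (2 * n + 2) * (1 + (2 * n + 2)) := by
        have := mul_le_mul hL1 (by linarith : 1 + L ≤ 1 + (2 * n + 2)) (by linarith) (by linarith)
        linarith
      have h2 : 12 * (2 * (n : ℝ) + 2) * (1 + (2 * n + 2)) ≤ 168 * (n : ℝ) ^ 2 + 72 := by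
        nlinarith
      exact hlow.trans (h1.trans h2)
    -- the increment floor
    have hincr : -C - (168 * (n : ℝ) ^ 2 + 72) ≤ keiperLiCoeff (n + 1) - keiperLiCoeff n := by
      have e : keiperLiCoeff (n + 1) - keiperLiCoeff n =
          highPart n (phaseCut n) + lowSum n (phaseCut n) := liIncr_eq_highPart_add_lowSum n _
      have h1 := (abs_le.1 hlow').1
      linarith
    -- polynomial ≤ exponential
    have hexp : 1 + ε * n + (ε * n) ^ 2 / 2 ≤ Real.exp (ε * n) := Real.quadratic_le_exp_of_nonneg (by positivity)
    have hE1 : 1 ≤ Real.exp (ε * n) := by nlinarith [sq_nonneg (ε * n), mul_nonneg hε.le hn0]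
    have hE2 : 168 * (n : ℝ) ^ 2 ≤ 336 / ε ^ 2 * Real.exp (ε * n) := by
      rw [div_mul_eq_mul_div, le_div_iff₀ (by positivity)]
      have : (n : ℝ) ^ 2 * ε ^ 2 = (ε * n) ^ 2 := by ring
      nlinarith [sq_nonneg (ε * n), mul_nonneg hε.le hn0]
    have hE3 : C ≤ |C| * Real.exp (ε * n) :=
      (le_abs_self C).trans (le_mul_of_one_le_right (abs_nonneg C) hE1)
    rw [one_mul]
    nlinarith [hE1, hE2, hE3, hincr, abs_nonneg C]
  exact hS

/-- Hence **RH ⟺ «the high part at the cut is eventually bounded below»** (RELABELLING; neither side asserted). -/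
theorem rh_iff_highPart_floor :
    _root_.RiemannHypothesis ↔ ∃ C : ℝ, ∀ᶠ n : ℕ in atTop, -C ≤ highPart n (phaseCut n) :=
  ⟨fun hRH ↦ ⟨17 / 2, highPart_floor_of_rh hRH⟩, fun ⟨_, h⟩ ↦ rh_of_highPart_floor h⟩

end Summit.RiemannHypothesis.RiemannHypothesis.Theorems.Splittings.LiLowPhaseLaw
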